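import Literature.Analysis.Fourier.HilbertTransformLineInvPow
import HarnessLib

/-!
# The Hilbert transform on the real span of `(L − iξ)^{−k}`, `k ≥ 2`

Topic `Literature/Analysis/Fourier`. Continuation of `HilbertTransformLineInvPow.lean`. The pair of identities
`H(Re F) = Im F`, `H(Im F) = −Re F` (`H = hilbertTransform`, convention `H cos = sin`) is stable under sums (given integrability of the
symmetric integrands), under REAL scalars and under multiplication by `i`; hence it holds for every finite real combination

  `F(ξ) = ∑_{j<n} c_j (L − iξ)^{−(j+2)}`   (`L > 0`, `c_j ∈ ℝ`)  — `hilbertTransform_cayleySum`,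

i.e. for the integrable rational functions `p(ξ)/(L − iξ)^m`, `deg p ≤ m − 2`, of King's table (entries (2.6), (2.13), (2.25) are
instances). These sums are exactly what the Cayley frame `(1 + cos θ)e^{inθ}`, `ξ = L tan(θ/2)`, expands into
(`Summits/NavierStokesRegularity/OSWSelfSimilar/SheetRCayleyHilbert.lean`). No definition.
[cite: King2009HilbertTransforms2, Appendix 1, Table 1.1 entries (1.1)–(1.3) (linearity, `H² = −1`) and Table 1.2 entries (2.2), (2.6), (2.13), (2.25)]
-/

namespace Literature.Analysis.Fourier

open _root_.MeasureTheory Set Filter Complex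
open scoped Real Topology

/-! ### Closure rules for the pair of identities `H(Re F) = Im F`, `H(Im F) = −Re F` -/

/-- The pair of identities `H(Re F)(x) = Im F(x)`, `H(Im F)(x) = −Re F(x)` is additive in `F`, given integrability
of the four symmetric integrands at `x` (linearity of `H`).
[cite: King2009HilbertTransforms2, Appendix 1, Table 1.1 entry (1.3) (additivity)] -/
theorem hilbertTransform_reIm_add {F G : ℝ → ℂ} {x : ℝ}
    (hFre : IntegrableOn (fun t => ((F (x - t)).re - (F (x + t)).re) / t) (Ioi 0))
    (hFim : IntegrableOn (fun t => ((F (x - t)).im - (F (x + t)).im) / t) (Ioi 0))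
    (hGre : IntegrableOn (fun t => ((G (x - t)).re - (G (x + t)).re) / t) (Ioi 0))
    (hGim : IntegrableOn (fun t => ((G (x - t)).im - (G (x + t)).im) / t) (Ioi 0))
    (hF : hilbertTransform (fun ξ => (F ξ).re) x = (F x).im ∧
      hilbertTransform (fun ξ => (F ξ).im) x = -(F x).re)
    (hG : hilbertTransform (fun ξ => (G ξ).re) x = (G x).im ∧
      hilbertTransform (fun ξ => (G ξ).im) x = -(G x).re) :
    hilbertTransform (fun ξ => (F ξ + G ξ).re) x = (F x + G x).im ∧
      hilbertTransform (fun ξ => (F ξ + G ξ).im) x = -(F x + G x).re := by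
  obtain ⟨hF1, hF2⟩ := hF
  obtain ⟨hG1, hG2⟩ := hG
  have ere : (fun ξ => (F ξ + G ξ).re) = fun ξ => (F ξ).re + (G ξ).re := by
    funext ξ; exact Complex.add_re _ _
  have eim : (fun ξ => (F ξ + G ξ).im) = fun ξ => (F ξ).im + (G ξ).im := by
    funext ξ; exact Complex.add_im _ _
  refine ⟨?_, ?_⟩
  · rw [ere, hilbertTransform_add (f := fun ξ => (F ξ).re) (g := fun ξ => (G ξ).re) hFre hGre, hF1, hG1,
      Complex.add_im]
  · rw [eim, hilbertTransform_add (f := fun ξ => (F ξ).im) (g := fun ξ => (G ξ).im) hFim hGim, hF2, hG2,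
      Complex.add_re, neg_add]

/-- The pair of identities is stable under multiplication by a REAL constant (no hypothesis; homogeneity of `H`).
[cite: King2009HilbertTransforms2, Appendix 1, Table 1.1 entries (1.1)–(1.3) (linearity)] -/
theorem hilbertTransform_reIm_ofReal_mul {F : ℝ → ℂ} {x : ℝ} (c : ℝ)
    (hF : hilbertTransform (fun ξ => (F ξ).re) x = (F x).im ∧
      hilbertTransform (fun ξ => (F ξ).im) x = -(F x).re) :
    hilbertTransform (fun ξ => ((c : ℂ) * F ξ).re) x = ((c : ℂ) * F x).im ∧
      hilbertTransform (fun ξ => ((c : ℂ) * F ξ).im) x = -((c : ℂ) * F x).re := by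
  obtain ⟨hF1, hF2⟩ := hF
  have ere : (fun ξ => ((c : ℂ) * F ξ).re) = fun ξ => c * (F ξ).re := by
    funext ξ; exact Complex.re_ofReal_mul _ _
  have eim : (fun ξ => ((c : ℂ) * F ξ).im) = fun ξ => c * (F ξ).im := by
    funext ξ; exact Complex.im_ofReal_mul _ _
  refine ⟨?_, ?_⟩
  · rw [ere, hilbertTransform_const_mul, hF1, Complex.im_ofReal_mul]
  · rw [eim, hilbertTransform_const_mul, hF2, Complex.re_ofReal_mul, mul_neg]

/-- The pair of identities is stable under multiplication by `i` (no hypothesis): `Re(iF) = −Im F`, `Im(iF) = Re F` — the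
pair `(f, g = Hf)` is mapped to the pair `(g, −f)`.
[cite: King2009HilbertTransforms2, Appendix 1, Table 1.1 entries (1.1), (1.2) (`f ↦ g`, `g ↦ −f`)] -/
theorem hilbertTransform_reIm_I_mul {F : ℝ → ℂ} {x : ℝ}
    (hF : hilbertTransform (fun ξ => (F ξ).re) x = (F x).im ∧
      hilbertTransform (fun ξ => (F ξ).im) x = -(F x).re) :
    hilbertTransform (fun ξ => (I * F ξ).re) x = (I * F x).im ∧
      hilbertTransform (fun ξ => (I * F ξ).im) x = -(I * F x).re := by
  obtain ⟨hF1, hF2⟩ := hF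
  have ere : (fun ξ => (I * F ξ).re) = fun ξ => -(F ξ).im := by
    funext ξ; simp
  have eim : (fun ξ => (I * F ξ).im) = fun ξ => (F ξ).re := by
    funext ξ; simp
  refine ⟨?_, ?_⟩
  · rw [ere, hilbertTransform_neg, hF2]; simp
  · rw [eim, hF1]; simp

/-! ### Finite real combinations of `w^{-(j+2)}` (numerator degree ≤ denominator degree − 2) -/

/-- A finite combination `∑_{j<n} c_j (L − iξ)^{-(j+2)}` is `C^∞` in `ξ`. [folklore] -/
private theorem contDiff_cayleySum {L : ℝ} (hL : 0 < L) (c : ℕ → ℝ) (n : ℕ) {m : WithTop ℕ∞} :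
    ContDiff ℝ m (fun ξ : ℝ => ∑ j ∈ Finset.range n, (c j : ℂ) * (((L : ℂ) - I * ξ) ^ (j + 2))⁻¹) :=
  ContDiff.sum fun j _ => contDiff_const.mul (contDiff_cayleyInvPow hL (j + 2))

/-- A finite combination `∑_{j<n} c_j (L − iξ)^{-(j+2)}` is integrable on `ℝ`. [folklore] -/
private theorem integrable_cayleySum {L : ℝ} (hL : 0 < L) (c : ℕ → ℝ) (n : ℕ) :
    Integrable (fun ξ : ℝ => ∑ j ∈ Finset.range n, (c j : ℂ) * (((L : ℂ) - I * ξ) ^ (j + 2))⁻¹) :=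
  integrable_finsetSum _ fun j _ => (integrable_cayleyInvPow hL (by omega : 2 ≤ j + 2)).const_mul _

/-- **`H(Re F) = Im F`, `H(Im F) = −Re F` for every finite real combination `F = ∑_{j<n} c_j (L − iξ)^{-(j+2)}`**
(the integrable members of the real span of the `(L − iξ)^{-k}`, i.e. real-coefficient rational functions
`p(ξ)/(L − iξ)^m` of this shape with numerator degree `≤ m − 2`; the table's entries `(bx + c)(x² + a²)⁻¹`, `(x² + a²)⁻²`,
`(ax³ + bx² + cx + d)(1 + x²)⁻²` are the cases `m ≤ 4` read in real and imaginary parts).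
[cite: King2009HilbertTransforms2, Appendix 1, Table 1.2 entries (2.2), (2.6), (2.13), (2.25)] -/
theorem hilbertTransform_cayleySum {L : ℝ} (hL : 0 < L) (c : ℕ → ℝ) (n : ℕ) (x : ℝ) :
    hilbertTransform (fun ξ : ℝ => (∑ j ∈ Finset.range n, (c j : ℂ) * (((L : ℂ) - I * ξ) ^ (j + 2))⁻¹).re) x
        = (∑ j ∈ Finset.range n, (c j : ℂ) * (((L : ℂ) - I * x) ^ (j + 2))⁻¹).im ∧
      hilbertTransform (fun ξ : ℝ => (∑ j ∈ Finset.range n, (c j : ℂ) * (((L : ℂ) - I * ξ) ^ (j + 2))⁻¹).im) x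
        = -(∑ j ∈ Finset.range n, (c j : ℂ) * (((L : ℂ) - I * x) ^ (j + 2))⁻¹).re := by
  induction n generalizing x with
  | zero =>
    simp [hilbertTransform]
  | succ n ih =>
    simp only [Finset.sum_range_succ]
    -- the previous partial sum `S` and the new term `T = c_n · w^{-(n+2)}` are `C¹ ∩ L¹`
    have hSC := contDiff_cayleySum hL c n (m := 1)
    have hSi := integrable_cayleySum hL c n
    have hTC : ContDiff ℝ 1 (fun ξ : ℝ => (c n : ℂ) * (((L : ℂ) - I * ξ) ^ (n + 2))⁻¹) :=
      contDiff_const.mul (contDiff_cayleyInvPow hL (n + 2))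
    have hTi : Integrable (fun ξ : ℝ => (c n : ℂ) * (((L : ℂ) - I * ξ) ^ (n + 2))⁻¹) :=
      (integrable_cayleyInvPow hL (by omega : 2 ≤ n + 2)).const_mul _
    exact hilbertTransform_reIm_add
      (F := fun ξ : ℝ => ∑ j ∈ Finset.range n, (c j : ℂ) * (((L : ℂ) - I * ξ) ^ (j + 2))⁻¹)
      (G := fun ξ : ℝ => (c n : ℂ) * (((L : ℂ) - I * ξ) ^ (n + 2))⁻¹)
      (integrableOn_symmIntegrand_of_contDiff (Complex.reCLM.contDiff.comp hSC) hSi.re x)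
      (integrableOn_symmIntegrand_of_contDiff (Complex.imCLM.contDiff.comp hSC) hSi.im x)
      (integrableOn_symmIntegrand_of_contDiff (Complex.reCLM.contDiff.comp hTC) hTi.re x)
      (integrableOn_symmIntegrand_of_contDiff (Complex.imCLM.contDiff.comp hTC) hTi.im x)
      (ih x) (hilbertTransform_reIm_ofReal_mul (c n) (hilbertTransform_cayleyInvPow hL (by omega) x))

end Literature.Analysis.Fourier
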